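import Literature.Probability.ODonnellSaksSchrammServedio2005.DecisionTreeCovarianceBiased
import HarnessLib

/-!
# Query strategies as reduced decision trees, and the OSSS inequality for strategies

Companion of `DecisionTreeCovarianceBiased.lean`.  In the sources a decision tree is an ADAPTIVE QUERY
STRATEGY: "`T_1(ω) = e_1` … `T_n(ω) = S_n[(T_i, ω(T_i))_{i<n}]` — a deterministic procedure for querying
the values of `ω ∈ {0,1}^E` that … chooses which values to query at each subsequent step as a function of
the values it has already observed" [Hutchcroft 2020, §2.3], and `δ_e` is "the probability that the
status of `e` is ever queried".  This file compiles such a strategy — a function `S` from partial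
assignments `σ : ι → Option Bool` to the next coordinate to query (`none` = halt), never querying an
assigned coordinate (`Legal`) — into a reduced `DecTree` (`build`, by recursion on a fuel parameter; fuel
`|ι| + 1` always suffices, `apply_run_eq_none`), and proves: the tree outputs the leaf label of the halting
state (`eval_build`), so it computes `g` whenever the labels are correct at every halting state consistent
with the input (`eval_tree_eq`); a coordinate queried along an input is the query of some state consistent
with that input (`exists_of_mem_queried`) — the hook for revealment bounds; and the two-function OSSS
inequality in strategy form (`osss_cov_strategy`):
`E_p[g G] − E_p[g] E_p[G] ≤ ∑_j P_p(j queried) · Inf_j^{ρ₁}[G]`.  Finite sums only.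

## References
* T. Hutchcroft, Probab. Math. Phys. 1 (2020), arXiv:1901.10363, §2.3 (decision trees, revealment
  `δ_e(T, μ)`). [Hutchcroft2020]
* R. O'Donnell, M. Saks, O. Schramm, R. A. Servedio, FOCS 2005, §1, §3. [OdonnellEtAl2005]
* H. Duminil-Copin, A. Raoufi, V. Tassion, Ann. of Math. 189 (2019), §2.1. [DuminilCopinRaoufiTassion2019]
-/

namespace Literature.Probability.ODonnellSaksSchrammServedio2005

open Finset Function

namespace Strategy

variable {ι : Type*}

/-- A partial assignment `σ` is consistent with the total input `x` when every assigned value agrees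
with `x` (non-Prop plumbing of the query model). [cite: Hutchcroft2020, §2.3 (decision trees)] -/
def Consistent (σ : ι → Option Bool) (x : ι → Bool) : Prop := ∀ i b, σ i = some b → x i = b

/-- A query strategy is legal when it only queries unassigned coordinates ("never queries a variable
more than once"). [cite: OdonnellEtAl2005, §3.2 proof of Thm 3.1 (no variable queried twice)] -/
def Legal (S : (ι → Option Bool) → Option ι) : Prop := ∀ σ i, S σ = some i → σ i = none

variable [DecidableEq ι]

/-- Compile a query strategy `S` with leaf labels `L` into a decision tree, with fuel `k`: query `S σ`,
branch on the answer, recurse on the extended assignment; output `L σ` when `S` halts or the fuel is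
spent. [cite: Hutchcroft2020, §2.3 (decision trees as query strategies)] -/
noncomputable def build (S : (ι → Option Bool) → Option ι) (L : (ι → Option Bool) → ℝ) :
    ℕ → (ι → Option Bool) → DecTree ι
  | 0, σ => DecTree.leaf (L σ)
  | k + 1, σ =>
    match S σ with
    | none => DecTree.leaf (L σ)
    | some i => DecTree.node i (build S L k (update σ i (some false)))
        (build S L k (update σ i (some true)))

/-- The state reached by running the strategy `S` on the input `x` from the state `σ` for at most `k`
queries. [cite: Hutchcroft2020, §2.3 (decision trees as query strategies)] -/
def run (S : (ι → Option Bool) → Option ι) : ℕ → (ι → Option Bool) → (ι → Bool) → (ι → Option Bool)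
  | 0, σ, _ => σ
  | k + 1, σ, x =>
    match S σ with
    | none => σ
    | some i => run S k (update σ i (some (x i))) x

/-- The compiled tree outputs the label of the state in which the run halts.
[cite: Hutchcroft2020, §2.3 (decision trees as query strategies)] -/
theorem eval_build (S : (ι → Option Bool) → Option ι) (L : (ι → Option Bool) → ℝ) (k : ℕ)
    (σ : ι → Option Bool) (x : ι → Bool) : (build S L k σ).eval x = L (run S k σ x) := by
  induction k generalizing σ with
  | zero => simp [build, run, DecTree.eval]
  | succ k ih =>
    cases hS : S σ with
    | none => simp [build, run, hS, DecTree.eval]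
    | some i =>
      simp only [build, run, hS, DecTree.eval]
      rcases Bool.eq_false_or_eq_true (x i) with hx | hx
      · simp [hx, ih]
      · simp [hx, ih]

/-- Every variable of the compiled tree is unassigned in the starting state (legality).
[cite: OdonnellEtAl2005, §3.2 proof of Thm 3.1 (no variable queried twice)] -/
theorem apply_eq_none_of_mem_vars_build {S : (ι → Option Bool) → Option ι} (hS : Legal S)
    (L : (ι → Option Bool) → ℝ) (k : ℕ) (σ : ι → Option Bool) {j : ι}
    (hj : j ∈ (build S L k σ).vars) : σ j = none := by
  induction k generalizing σ with
  | zero => simp [build, DecTree.vars] at hj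
  | succ k ih =>
    cases hSσ : S σ with
    | none => simp [build, hSσ, DecTree.vars] at hj
    | some i =>
      simp only [build, hSσ, DecTree.vars, Finset.mem_insert, Finset.mem_union] at hj
      rcases hj with rfl | hj | hj
      · exact hS σ j hSσ
      · have h := ih _ hj
        by_cases hji : j = i
        · subst hji; simp at h
        · rwa [update_of_ne hji] at h
      · have h := ih _ hj
        by_cases hji : j = i
        · subst hji; simp at h
        · rwa [update_of_ne hji] at h

/-- The compiled tree of a legal strategy is reduced.
[cite: OdonnellEtAl2005, §3.2 proof of Thm 3.1 (no variable queried twice)] -/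
theorem reduced_build {S : (ι → Option Bool) → Option ι} (hS : Legal S) (L : (ι → Option Bool) → ℝ)
    (k : ℕ) (σ : ι → Option Bool) : (build S L k σ).Reduced := by
  induction k generalizing σ with
  | zero => simp [build, DecTree.Reduced]
  | succ k ih =>
    cases hSσ : S σ with
    | none => simp [build, hSσ, DecTree.Reduced]
    | some i =>
      simp only [build, hSσ, DecTree.Reduced]
      refine ⟨fun h => ?_, fun h => ?_, ih _, ih _⟩
      · have := apply_eq_none_of_mem_vars_build hS L k _ h
        simp at this
      · have := apply_eq_none_of_mem_vars_build hS L k _ h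
        simp at this

omit [DecidableEq ι] in
/-- Extending a consistent assignment by the true value of a coordinate keeps it consistent.
[cite: Hutchcroft2020, §2.3 (decision trees)] -/
theorem Consistent.update [DecidableEq ι] {σ : ι → Option Bool} {x : ι → Bool} (h : Consistent σ x)
    (i : ι) : Consistent (Function.update σ i (some (x i))) x := by
  intro j b hj
  by_cases hji : j = i
  · subst hji; simp at hj; exact hj
  · rw [update_of_ne hji] at hj; exact h j b hj

/-- REVEALMENT HOOK: a coordinate queried by the compiled tree along the input `x` is the query of the
strategy at some state consistent with `x`. [cite: Hutchcroft2020, §2.3 (revealment probability δ_e)] -/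
theorem exists_of_mem_queried (S : (ι → Option Bool) → Option ι) (L : (ι → Option Bool) → ℝ) (k : ℕ)
    {σ : ι → Option Bool} {x : ι → Bool} (hσ : Consistent σ x) {j : ι}
    (hj : j ∈ (build S L k σ).queried x) : ∃ σ', Consistent σ' x ∧ S σ' = some j := by
  induction k generalizing σ with
  | zero => simp [build, DecTree.queried] at hj
  | succ k ih =>
    cases hSσ : S σ with
    | none => simp [build, hSσ, DecTree.queried] at hj
    | some i =>
      simp only [build, hSσ, DecTree.queried, Finset.mem_insert] at hj
      rcases hj with rfl | hj
      · exact ⟨σ, hσ, hSσ⟩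
      · rcases Bool.eq_false_or_eq_true (x i) with hx | hx
        · rw [if_pos hx] at hj
          have hc := hσ.update i
          rw [hx] at hc
          exact ih hc hj
        · rw [if_neg (by simp [hx])] at hj
          have hc := hσ.update i
          rw [hx] at hc
          exact ih hc hj

/-- Running a strategy preserves consistency with the input. [cite: Hutchcroft2020, §2.3 (decision trees)] -/
theorem consistent_run (S : (ι → Option Bool) → Option ι) (k : ℕ) {σ : ι → Option Bool} {x : ι → Bool}
    (hσ : Consistent σ x) : Consistent (run S k σ x) x := by
  induction k generalizing σ with
  | zero => simpa [run] using hσ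
  | succ k ih =>
    cases hSσ : S σ with
    | none => simpa [run, hSσ] using hσ
    | some i => simp only [run, hSσ]; exact ih (hσ.update i)

variable [Fintype ι]

/-- Number of unassigned coordinates of a partial assignment (plumbing). [folklore] -/
def noneCount (σ : ι → Option Bool) : ℕ := (univ.filter fun i => σ i = none).card

/-- Assigning an unassigned coordinate lowers `noneCount` by one. [folklore] -/
private theorem noneCount_update {σ : ι → Option Bool} {i : ι} (hi : σ i = none) (b : Bool) :
    noneCount (Function.update σ i (some b)) + 1 = noneCount σ := by
  unfold noneCount
  have hset : (univ.filter fun j => Function.update σ i (some b) j = none)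
      = (univ.filter fun j => σ j = none).erase i := by
    ext j
    by_cases hji : j = i
    · subst hji; simp
    · simp [hji]
  rw [hset, Finset.card_erase_add_one]
  simpa using hi

/-- A legal strategy that has not halted after `k` queries has used up `k` unassigned coordinates.
[cite: OdonnellEtAl2005, §3.2 proof of Thm 3.1 (no variable queried twice)] -/
theorem noneCount_run_add_le {S : (ι → Option Bool) → Option ι} (hS : Legal S) (k : ℕ)
    (σ : ι → Option Bool) (x : ι → Bool) (h : S (run S k σ x) ≠ none) :
    noneCount (run S k σ x) + k ≤ noneCount σ := by
  induction k generalizing σ with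
  | zero => simp [run]
  | succ k ih =>
    cases hSσ : S σ with
    | none => simp [run, hSσ] at h
    | some i =>
      simp only [run, hSσ] at h ⊢
      have h1 := ih _ h
      have h2 := noneCount_update (hS σ i hSσ) (x i)
      omega

/-- With fuel `|ι| + 1` every legal strategy halts: the final state is a halting state.
[cite: Hutchcroft2020, §2.3 (decision trees as query strategies)] -/
theorem apply_run_eq_none {S : (ι → Option Bool) → Option ι} (hS : Legal S) (σ : ι → Option Bool)
    (x : ι → Bool) : S (run S (Fintype.card ι + 1) σ x) = none := by
  by_contra h
  have h1 := noneCount_run_add_le hS _ σ x h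
  have h2 : noneCount σ ≤ Fintype.card ι := Finset.card_le_univ _
  omega

/-- The decision tree of a strategy: compiled from the empty assignment with fuel `|ι| + 1`.
[cite: Hutchcroft2020, §2.3 (decision trees as query strategies)] -/
noncomputable def tree (S : (ι → Option Bool) → Option ι) (L : (ι → Option Bool) → ℝ) : DecTree ι :=
  build S L (Fintype.card ι + 1) (fun _ => none)

/-- CORRECTNESS: if the leaf labels are right at every halting state consistent with the input, the tree
of the strategy computes `g`. [cite: Hutchcroft2020, §2.3 (a decision tree computes f)] -/
theorem eval_tree_eq {S : (ι → Option Bool) → Option ι} (hS : Legal S) {L : (ι → Option Bool) → ℝ}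
    {g : (ι → Bool) → ℝ} (hL : ∀ σ x, Consistent σ x → S σ = none → L σ = g x) (x : ι → Bool) :
    (tree S L).eval x = g x := by
  rw [tree, eval_build]
  exact hL _ _ (consistent_run S _ (fun i b h => by simp at h)) (apply_run_eq_none hS _ x)

/-- The revealment probability of coordinate `j` under the biased product law: `P_p(j is queried)`.
[cite: Hutchcroft2020, §2.3 (revealment probability δ_e(T, μ))] -/
noncomputable def revealment (p : ι → ℝ) (S : (ι → Option Bool) → Option ι)
    (L : (ι → Option Bool) → ℝ) (j : ι) : ℝ :=
  ∑ x, wt p x * (if j ∈ (tree S L).queried x then 1 else 0)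

/-- REVEALMENT BOUND: if every input along which `j` is queried lies in an event `A` (witnessed through
the querying state), then `P_p(j queried) ≤ P_p(A)`. [cite: Hutchcroft2020, §3 proof of Prop 3.1 (bound on δ_e)] -/
theorem revealment_le {p : ι → ℝ} (h0 : ∀ i, 0 ≤ p i) (h1 : ∀ i, p i ≤ 1)
    (S : (ι → Option Bool) → Option ι) (L : (ι → Option Bool) → ℝ) (j : ι) (A : (ι → Bool) → Prop)
    [DecidablePred A] (hA : ∀ σ x, Consistent σ x → S σ = some j → A x) :
    revealment p S L j ≤ ∑ x, wt p x * (if A x then 1 else 0) := by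
  refine Finset.sum_le_sum fun x _ => mul_le_mul_of_nonneg_left ?_ (wt_nonneg h0 h1 x)
  split_ifs with hq hx
  · exact le_rfl
  · obtain ⟨σ', hc, hS⟩ := exists_of_mem_queried S L _ (fun i b h => by simp at h) hq
    exact absurd (hA σ' x hc hS) hx
  · exact zero_le_one
  · exact le_rfl

/-- THE TWO-FUNCTION OSSS INEQUALITY FOR A QUERY STRATEGY: if the legal strategy `S` with labels `L`
computes `g` (`|g| ≤ 1`), then for every `G`,
`E_p[g G] − E_p[g] E_p[G] ≤ ∑_j P_p(j queried) · Inf_j^{ρ₁}[G]`.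
[cite: OdonnellEtAl2005, §3.3 Thm 3.2 (alternate version)] -/
theorem osss_cov_strategy (p : ι → ℝ) (h0 : ∀ i, 0 ≤ p i) (h1 : ∀ i, p i ≤ 1)
    {S : (ι → Option Bool) → Option ι} (hS : Legal S) (L : (ι → Option Bool) → ℝ)
    {g : (ι → Bool) → ℝ} (hg : ∀ x, |g x| ≤ 1)
    (hL : ∀ σ x, Consistent σ x → S σ = none → L σ = g x) (G : (ι → Bool) → ℝ) :
    (∑ y, wt p y * (g y * G y)) - (∑ y, wt p y * g y) * (∑ y, wt p y * G y)
      ≤ ∑ j, revealment p S L j * infl p j G := by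
  have hev : ∀ y, (tree S L).eval y = g y := eval_tree_eq hS hL
  have hred : (tree S L).Reduced := reduced_build hS L _ _
  have key := DecTree.osss_cov p h0 h1 (tree S L) hred (fun y => by rw [hev y]; exact hg y) G
  simp only [hev] at key
  refine key.trans (le_of_eq (Finset.sum_congr rfl fun j _ => ?_))
  rw [DecTree.qprob_eq_sum_queried p _ hred, revealment]

end Strategy

end Literature.Probability.ODonnellSaksSchrammServedio2005
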